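import Literature.Probability.Process.ExitTimeContinuity
import Mathlib.MeasureTheory.Measure.Typeclasses.SFinite
import HarnessLib

/-!
# Unclean exits happen only at local-extremum levels: all but countably many levels are almost surely clean

Topic `Literature/Probability/Process`; theorems only. Sequel of `ExitTimeContinuity.lean`, which
proves that the stopped clock `u ∧ τ(p)` and stopped value on the path space `C([0, ∞), ℝ)` are
continuous at every path `p₀` leaving the level interval `(a, b)` CLEANLY (right after the exit time
the path visits the complement of the closed interval `[a, b]`).  Here:

* `exists_rat_sInf_eq_or_sSup_eq_of_not_clean` — DETERMINISTIC: if a path started in `(a, b)`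
  exits at the finite time `T` and the exit is NOT clean, then `a` is the minimum of the path on a
  rational time interval containing `T` (exit through `a`), or `b` is its maximum there (exit
  through `b`) — an unclean exit level is a local-extremum value of the path;
* `countable_setOf_measure_sInf_pos`, `countable_setOf_measure_sSup_pos` — for a finite (s-finite)
  Borel measure `ν` on path space, the levels charged by the law of the minimum (resp. maximum) of the
  path over some rational time interval form a COUNTABLE set (atoms of countably many real random
  variables, Mathlib `Measure.countable_meas_pos_of_disjoint_iUnion`);
* `exists_countable_forall_ae_clean` — hence there are countable sets `A, B ⊆ ℝ` such that for all
  levels `a ∉ A`, `b ∉ B`, `ν`-almost every path started in `(a, b)` has a clean exit from `(a, b)`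
  (or none), in the exact hypothesis format of `continuousAt_untopA_min_exitTime`.

This is the probabilistic half of the fact quoted in the passage of level-stopped martingale
observables to the scaling limit (Camia–Newman, PTRF 139 (2007), §5; Billingsley 1999, §2: the
discontinuity set of the stopping functional is null for all but countably many levels).

## References

* F. Camia, C. M. Newman, Probab. Theory Related Fields 139 (2007) 473–519, §5. [CamiaNewman2007]
* P. Billingsley, *Convergence of Probability Measures*, 2nd ed. (1999), §2. [Billingsley1999]
-/

noncomputable section

open MeasureTheory Filter Topology Set
open scoped NNReal ENNReal

namespace Literature.Probability.Process

section CleanLevels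

variable {a b : ℝ}

/-- **An unclean exit level is a local-extremum value.**  Let the path `p` start in `(a, b)` and
exit at the finite time `T`.  If the exit is not clean — for some `ε > 0` the path stays in `[a, b]`
on `(T, T + ε)` — then there are rationals `0 ≤ q₁ < q₂` with `T ∈ [q₁, q₂]` such that `a` is the
minimum of `p` on `[q₁, q₂]` (exit through `a`) or `b` is its maximum there (exit through `b`).
[folklore] -/
theorem exists_rat_sInf_eq_or_sSup_eq_of_not_clean {p : C(ℝ≥0, ℝ)} (h0 : p 0 ∈ Ioo a b)
    {T : ℝ≥0} (hT : exitTime (fun t (q : C(ℝ≥0, ℝ)) ↦ q t) a b p = T)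
    (hnot : ¬ ∀ ε : ℝ, 0 < ε → ∃ s : ℝ≥0, T < s ∧ (s : ℝ) < T + ε ∧ p s ∉ Icc a b) :
    ∃ q₁ q₂ : ℚ, 0 ≤ q₁ ∧ q₁ < q₂ ∧
      (sInf (p '' Icc (Real.toNNReal q₁) (Real.toNNReal q₂)) = a ∨
        sSup (p '' Icc (Real.toNNReal q₁) (Real.toNNReal q₂)) = b) := by
  push Not at hnot
  obtain ⟨ε, hε, hstay⟩ := hnot
  -- the exit time is positive; rationals `0 < q₁ < T < q₂ < T + ε`
  have hTpos : (0 : ℝ) < T := by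
    have := exitTime_pos (u := fun t (q : C(ℝ≥0, ℝ)) ↦ q t) (ω := p) p.continuous h0
    rw [hT, WithTop.coe_pos] at this
    exact_mod_cast this
  obtain ⟨q₁, hq₁0, hq₁T⟩ := exists_rat_btwn hTpos
  obtain ⟨q₂, hTq₂, hq₂ε⟩ := exists_rat_btwn (show (T : ℝ) < T + ε by linarith)
  have hq₁0' : (0 : ℝ) ≤ q₁ := hq₁0.le
  have hq₂0' : (0 : ℝ) ≤ q₂ := hTpos.le.trans hTq₂.le
  have hc₁ : ((Real.toNNReal q₁ : ℝ≥0) : ℝ) = q₁ := Real.coe_toNNReal _ hq₁0'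
  have hc₂ : ((Real.toNNReal q₂ : ℝ≥0) : ℝ) = q₂ := Real.coe_toNNReal _ hq₂0'
  have hq₁T' : Real.toNNReal q₁ ≤ T := by
    rw [← NNReal.coe_le_coe, hc₁]; exact hq₁T.le
  have hTq₂' : T ≤ Real.toNNReal q₂ := by
    rw [← NNReal.coe_le_coe, hc₂]; exact hTq₂.le
  have hTmem : T ∈ Icc (Real.toNNReal q₁) (Real.toNNReal q₂) := ⟨hq₁T', hTq₂'⟩
  -- on `[q₁, q₂]` the path is in `[a, b]`
  have hIcc : ∀ s ∈ Icc (Real.toNNReal q₁) (Real.toNNReal q₂), p s ∈ Icc a b := by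
    intro s hs
    rcases lt_trichotomy s T with hlt | heq | hgt
    · exact Ioo_subset_Icc_self (mem_Ioo_of_coe_lt_exitTime (u := fun t (q : C(ℝ≥0, ℝ)) ↦ q t)
        (by rw [hT]; exact WithTop.coe_lt_coe.2 hlt))
    · rw [heq]
      rcases apply_eq_or_eq_of_exitTime_eq_coe (u := fun t (q : C(ℝ≥0, ℝ)) ↦ q t) (ω := p)
        p.continuous h0 hT with h | h
      · rw [h]; exact left_mem_Icc.2 (h0.1.le.trans h0.2.le)
      · rw [h]; exact right_mem_Icc.2 (h0.1.le.trans h0.2.le)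
    · have hs2 : (s : ℝ) < T + ε := by
        have : (s : ℝ) ≤ Real.toNNReal q₂ := NNReal.coe_le_coe.2 hs.2
        rw [hc₂] at this
        linarith
      exact hstay s hgt hs2
  refine ⟨q₁, q₂, by exact_mod_cast hq₁0', by exact_mod_cast hq₁T.trans hTq₂, ?_⟩
  have hne : (p '' Icc (Real.toNNReal q₁) (Real.toNNReal q₂)).Nonempty := ⟨_, T, hTmem, rfl⟩
  rcases apply_eq_or_eq_of_exitTime_eq_coe (u := fun t (q : C(ℝ≥0, ℝ)) ↦ q t) (ω := p)
    p.continuous h0 hT with ha | hb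
  · left
    refine IsLeast.csInf_eq ⟨⟨T, hTmem, ha⟩, ?_⟩
    rintro _ ⟨s, hs, rfl⟩
    exact (hIcc s hs).1
  · right
    refine IsGreatest.csSup_eq ⟨⟨T, hTmem, hb⟩, ?_⟩
    rintro _ ⟨s, hs, rfl⟩
    exact (hIcc s hs).2

/-- The minimum of a path over a compact time interval is a continuous functional of the path.
[folklore] -/
theorem continuous_sInf_image_Icc (u v : ℝ≥0) :
    Continuous fun p : C(ℝ≥0, ℝ) ↦ sInf (p '' Icc u v) :=
  isCompact_Icc.continuous_sInf (f := fun (p : C(ℝ≥0, ℝ)) (t : ℝ≥0) ↦ p t) continuous_eval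

/-- The maximum of a path over a compact time interval is a continuous functional of the path.
[folklore] -/
theorem continuous_sSup_image_Icc (u v : ℝ≥0) :
    Continuous fun p : C(ℝ≥0, ℝ) ↦ sSup (p '' Icc u v) :=
  isCompact_Icc.continuous_sSup (f := fun (p : C(ℝ≥0, ℝ)) (t : ℝ≥0) ↦ p t) continuous_eval

variable [MeasurableSpace C(ℝ≥0, ℝ)] [OpensMeasurableSpace C(ℝ≥0, ℝ)]
  (ν : Measure C(ℝ≥0, ℝ)) [SFinite ν]

/-- **The levels charged by the minima over rational intervals are countable**: for an s-finite
Borel measure on path space, `{x | ∃ q₁ q₂, ν{p | min_{[q₁,q₂]} p = x} > 0}` is countable (atoms of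
countably many real random variables). [folklore] -/
theorem countable_setOf_measure_sInf_pos :
    {x : ℝ | ∃ q₁ q₂ : ℚ, 0 < ν {p : C(ℝ≥0, ℝ) |
      sInf (p '' Icc (Real.toNNReal q₁) (Real.toNNReal q₂)) = x}}.Countable := by
  have hsub : {x : ℝ | ∃ q₁ q₂ : ℚ, 0 < ν {p : C(ℝ≥0, ℝ) |
      sInf (p '' Icc (Real.toNNReal q₁) (Real.toNNReal q₂)) = x}} ⊆
      ⋃ q : ℚ × ℚ, {x : ℝ | 0 < ν ((fun p : C(ℝ≥0, ℝ) ↦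
        sInf (p '' Icc (Real.toNNReal q.1) (Real.toNNReal q.2))) ⁻¹' {x})} := by
    rintro x ⟨q₁, q₂, hx⟩
    exact mem_iUnion.2 ⟨(q₁, q₂), hx⟩
  refine (Set.countable_iUnion fun q ↦ ?_).mono hsub
  refine Measure.countable_meas_pos_of_disjoint_iUnion (μ := ν)
    (fun x ↦ (continuous_sInf_image_Icc _ _).measurable (measurableSet_singleton x)) ?_
  intro x y hxy
  exact Disjoint.preimage _ (disjoint_singleton.2 hxy)

/-- **The levels charged by the maxima over rational intervals are countable.** [folklore] -/
theorem countable_setOf_measure_sSup_pos :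
    {x : ℝ | ∃ q₁ q₂ : ℚ, 0 < ν {p : C(ℝ≥0, ℝ) |
      sSup (p '' Icc (Real.toNNReal q₁) (Real.toNNReal q₂)) = x}}.Countable := by
  have hsub : {x : ℝ | ∃ q₁ q₂ : ℚ, 0 < ν {p : C(ℝ≥0, ℝ) |
      sSup (p '' Icc (Real.toNNReal q₁) (Real.toNNReal q₂)) = x}} ⊆
      ⋃ q : ℚ × ℚ, {x : ℝ | 0 < ν ((fun p : C(ℝ≥0, ℝ) ↦
        sSup (p '' Icc (Real.toNNReal q.1) (Real.toNNReal q.2))) ⁻¹' {x})} := by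
    rintro x ⟨q₁, q₂, hx⟩
    exact mem_iUnion.2 ⟨(q₁, q₂), hx⟩
  refine (Set.countable_iUnion fun q ↦ ?_).mono hsub
  refine Measure.countable_meas_pos_of_disjoint_iUnion (μ := ν)
    (fun x ↦ (continuous_sSup_image_Icc _ _).measurable (measurableSet_singleton x)) ?_
  intro x y hxy
  exact Disjoint.preimage _ (disjoint_singleton.2 hxy)

/-- **All but countably many levels are almost surely clean.**  For an s-finite Borel measure `ν`
on `C([0, ∞), ℝ)` there are countable sets `A, B ⊆ ℝ` such that for all levels `a ∉ A` and
`b ∉ B`, `ν`-almost every path `p` started in `(a, b)` leaves `(a, b)` cleanly or never: whenever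
its exit time is the finite time `T`, for every `ε > 0` some `s ∈ (T, T + ε)` has `p s ∉ [a, b]`
(the hypothesis of `continuousAt_untopA_min_exitTime`). [cite: CamiaNewman2007, §5] -/
theorem exists_countable_forall_ae_clean :
    ∃ A B : Set ℝ, A.Countable ∧ B.Countable ∧ ∀ a ∉ A, ∀ b ∉ B,
      ∀ᵐ p ∂ν, p 0 ∈ Ioo a b → ∀ T : ℝ≥0,
        exitTime (fun t (q : C(ℝ≥0, ℝ)) ↦ q t) a b p = T →
          ∀ ε : ℝ, 0 < ε → ∃ s : ℝ≥0, T < s ∧ (s : ℝ) < T + ε ∧ p s ∉ Icc a b := by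
  refine ⟨_, _, countable_setOf_measure_sInf_pos ν, countable_setOf_measure_sSup_pos ν,
    fun a ha b hb ↦ ?_⟩
  simp only [mem_setOf_eq, not_exists, not_lt, nonpos_iff_eq_zero] at ha hb
  -- the exceptional set: some rational-interval minimum equals `a` or maximum equals `b`
  have hnullA : ∀ᵐ (p : C(ℝ≥0, ℝ)) ∂ν, ∀ q : ℚ × ℚ,
      sInf (p '' Icc (Real.toNNReal q.1) (Real.toNNReal q.2)) ≠ a := by
    rw [ae_all_iff]
    intro q
    rw [ae_iff]
    simpa only [ne_eq, not_not] using ha q.1 q.2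
  have hnullB : ∀ᵐ (p : C(ℝ≥0, ℝ)) ∂ν, ∀ q : ℚ × ℚ,
      sSup (p '' Icc (Real.toNNReal q.1) (Real.toNNReal q.2)) ≠ b := by
    rw [ae_all_iff]
    intro q
    rw [ae_iff]
    simpa only [ne_eq, not_not] using hb q.1 q.2
  filter_upwards [hnullA, hnullB] with p hpa hpb h0 T hT
  by_contra hnot
  obtain ⟨q₁, q₂, -, -, h⟩ := exists_rat_sInf_eq_or_sSup_eq_of_not_clean h0 hT hnot
  rcases h with h | h
  · exact hpa (q₁, q₂) h
  · exact hpb (q₁, q₂) h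

/-! ### One-sided version: exits through a prescribed endpoint -/

omit [MeasurableSpace C(ℝ≥0, ℝ)] [OpensMeasurableSpace C(ℝ≥0, ℝ)] in
/-- **An unclean exit THROUGH `a` makes `a` a local-minimum value**: as
`exists_rat_sInf_eq_or_sSup_eq_of_not_clean`, when the path sits at `a` at its exit time.
[folklore] -/
theorem exists_rat_sInf_eq_of_not_clean_of_apply_eq {p : C(ℝ≥0, ℝ)} (h0 : p 0 ∈ Ioo a b)
    {T : ℝ≥0} (hT : exitTime (fun t (q : C(ℝ≥0, ℝ)) ↦ q t) a b p = T) (hTa : p T = a)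
    (hnot : ¬ ∀ ε : ℝ, 0 < ε → ∃ s : ℝ≥0, T < s ∧ (s : ℝ) < T + ε ∧ p s ∉ Icc a b) :
    ∃ q₁ q₂ : ℚ, sInf (p '' Icc (Real.toNNReal q₁) (Real.toNNReal q₂)) = a := by
  push Not at hnot
  obtain ⟨ε, hε, hstay⟩ := hnot
  have hTpos : (0 : ℝ) < T := by
    have := exitTime_pos (u := fun t (q : C(ℝ≥0, ℝ)) ↦ q t) (ω := p) p.continuous h0
    rw [hT, WithTop.coe_pos] at this
    exact_mod_cast this
  obtain ⟨q₁, hq₁0, hq₁T⟩ := exists_rat_btwn hTpos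
  obtain ⟨q₂, hTq₂, hq₂ε⟩ := exists_rat_btwn (show (T : ℝ) < T + ε by linarith)
  have hq₁0' : (0 : ℝ) ≤ q₁ := hq₁0.le
  have hq₂0' : (0 : ℝ) ≤ q₂ := hTpos.le.trans hTq₂.le
  have hc₁ : ((Real.toNNReal q₁ : ℝ≥0) : ℝ) = q₁ := Real.coe_toNNReal _ hq₁0'
  have hc₂ : ((Real.toNNReal q₂ : ℝ≥0) : ℝ) = q₂ := Real.coe_toNNReal _ hq₂0'
  have hq₁T' : Real.toNNReal q₁ ≤ T := by
    rw [← NNReal.coe_le_coe, hc₁]; exact hq₁T.le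
  have hTq₂' : T ≤ Real.toNNReal q₂ := by
    rw [← NNReal.coe_le_coe, hc₂]; exact hTq₂.le
  have hTmem : T ∈ Icc (Real.toNNReal q₁) (Real.toNNReal q₂) := ⟨hq₁T', hTq₂'⟩
  have hIcc : ∀ s ∈ Icc (Real.toNNReal q₁) (Real.toNNReal q₂), a ≤ p s := by
    intro s hs
    rcases lt_trichotomy s T with hlt | heq | hgt
    · exact (mem_Ioo_of_coe_lt_exitTime (u := fun t (q : C(ℝ≥0, ℝ)) ↦ q t)
        (by rw [hT]; exact WithTop.coe_lt_coe.2 hlt)).1.le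
    · rw [heq, hTa]
    · have hs2 : (s : ℝ) < T + ε := by
        have : (s : ℝ) ≤ Real.toNNReal q₂ := NNReal.coe_le_coe.2 hs.2
        rw [hc₂] at this
        linarith
      exact (hstay s hgt hs2).1
  refine ⟨q₁, q₂, IsLeast.csInf_eq ⟨⟨T, hTmem, hTa⟩, ?_⟩⟩
  rintro _ ⟨s, hs, rfl⟩
  exact hIcc s hs

/-- **All but countably many LOWER levels are almost surely clean for exits through them**: there
is a countable `A ⊆ ℝ` such that for all `a ∉ A` and every `b`, `ν`-a.e. path started in `(a, b)`
which leaves `(a, b)` at a finite time through `a` does so cleanly (no condition on `b`: the form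
needed for level intervals whose upper level is never reached). [cite: CamiaNewman2007, §5] -/
theorem exists_countable_forall_ae_clean_left :
    ∃ A : Set ℝ, A.Countable ∧ ∀ a ∉ A, ∀ b : ℝ,
      ∀ᵐ p ∂ν, p 0 ∈ Ioo a b → ∀ T : ℝ≥0,
        exitTime (fun t (q : C(ℝ≥0, ℝ)) ↦ q t) a b p = T → p T = a →
          ∀ ε : ℝ, 0 < ε → ∃ s : ℝ≥0, T < s ∧ (s : ℝ) < T + ε ∧ p s ∉ Icc a b := by
  refine ⟨_, countable_setOf_measure_sInf_pos ν, fun a ha b ↦ ?_⟩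
  simp only [mem_setOf_eq, not_exists, not_lt, nonpos_iff_eq_zero] at ha
  have hnullA : ∀ᵐ (p : C(ℝ≥0, ℝ)) ∂ν, ∀ q : ℚ × ℚ,
      sInf (p '' Icc (Real.toNNReal q.1) (Real.toNNReal q.2)) ≠ a := by
    rw [ae_all_iff]
    intro q
    rw [ae_iff]
    simpa only [ne_eq, not_not] using ha q.1 q.2
  filter_upwards [hnullA] with p hpa h0 T hT hTa
  by_contra hnot
  obtain ⟨q₁, q₂, h⟩ := exists_rat_sInf_eq_of_not_clean_of_apply_eq h0 hT hTa hnot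
  exact hpa (q₁, q₂) h

end CleanLevels

end Literature.Probability.Process

end
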